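import Summits.CriticalPhenomena.PercolationContinuityZ3.Theorems.PercNearOneGluingNoHeavyLowerTailWorstPairExchangeCex
import HarnessLib

/-!
# `NoHeavyLowerTail` (stmt-CriticalPhenomena-4575) — k-cluster line: the tripod exchange (C⁺) does NOT survive a
# two-sided guard (certified 7-vertex "twisted ladder" witness)

Support file (prover `prim-hp-7`, hull-port prover #7, technique "k-cluster conditional association"; `--supports
stmt-CriticalPhenomena-4575`).  Computational (`native_decide` on 512-term exact rational sums, evaluation pattern of
`PercNearOneGluingNoHeavyLowerTailThreeClusterCPACex.lean` on `Fin 7`).  No definitions, no named facts, no sorries.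

**Background.**  The tripod exchange (C⁺), `μ(D ∩ {s↔a} ∩ {t↔b}) · μ(D ∩ {s↔b} ∩ {t↔a}) ≤ μ(D ∩ {s↔a} ∩ {s↔b}) · μ(D ∩ {t↔a} ∩ {t↔b})`
with `D = {s ↮ t}`, is a theorem (tree: `Literature.Probability.Percolation.tripodExchange`, a corollary of
[VandenbergHaggstromKahn2005, Thm. 1.5]).  The k-cluster line of the hull-port programme asked whether it survives the TWO-SIDED guard
`D₃ = {s ↮ t} ∩ {s ↮ u} ∩ {t ↮ u}` (a third vertex `u` separated from both sources) — statement "T3" of the seat memos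
run/shared/lean/prim/prim-hp-7/HP7-K3-INVENTORY.md §2, §7–§13 and HP7-GX-FAMILY.md, the last three-cluster cell of that inventory without a
known violation (0 in ≈ 5·10⁵ random exact instances `n ≤ 8` and ≈ 2·10⁴ adversarial climbs `n ≤ 7`).

**This file: it is false.**  Witness found by the census engine ttrl2 (run/shared/lean/ttrl/k3cells/README.md, RESULT 04:55Z 2026-08-19,
"twisted ladder" V9; three independent evaluators there, a fourth — the seat's partition-law engine — in HP7-GX-FAMILY.md): `Fin 7`, `s = 0`,
`t = 1`, `u = 2`, `a = 3`, `b = 4`, `p = 5`, `q = 6`; light pairs `s–a, s–p, t–b, t–q, a–q, b–p, p–q` of weight `1/2` and hub pairs `u–p, u–q` of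
weight `10/11`, all other pairs `0`.  Exactly: `μ(D₃ ∩ {0↔3} ∩ {0↔4}) = μ(D₃ ∩ {1↔3} ∩ {1↔4}) = 17/15488`, `μ(D₃ ∩ {0↔3} ∩ {1↔4}) = 149/7744`,
`μ(D₃ ∩ {0↔4} ∩ {1↔3}) = 1/15488`, so `L − R = (17/15488)² − (149/7744)(1/15488) = −9/239878144 < 0` (`μ(D₃) = 311/1936 ≈ 0.16`: the
guard is NOT rare).  Mechanism (ttrl2): on the main branch (both hub pairs open, so `p, q ∈ C_u`) the marker `a` can only join `s` and `b` only `t`,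
hence the cross cell `{s↔a, t↔b}` is generic while each same-side cell needs one hub pair closed and `{s↔b, t↔a}` needs both: both sides of (C⁺)
are of second order in the hub failure probability and the constants give `R/L → 2`.  The violation persists on the whole region
{hub weight ≥ 0.904, light weight 1/2} and, on 9 vertices, even with all weights ≤ 1/2 (ttrl2, loc. cit.).

Consequence for the line (HP7-GX-FAMILY.md §1): with `ThreeClusterNegCorrCex` (Thm. 1.4 + guard) and `ThreeClusterCPACex` (Thm. 1.2 + clique
separation) every hypothesis-free conditional-association cell of the three-cluster world `{s | t | u}` is refuted, balanced ones included.

* `GuardedTripodCex.real_D3_conn_conn` — evaluation of `μ(D₃ ∩ ({x ↔ c} ∩ {y ↔ d}))` on `Fin 7` as an exact weighted count;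
* `GuardedTripodCex.violation_of_check` — one decidable rational fact ⇒ the violating instance;
* `guardedTripod_cex` — the instance;  `guardedTripod_false` — `¬`(tripod exchange with a two-sided guard), all finite weighted graphs.
-/

namespace Summit.CriticalPhenomena.PercolationContinuityZ3.Theorems

open MeasureTheory
open Literature.Probability.LatticeModels Literature.Probability.Percolation
open Summit.CriticalPhenomena.PercolationContinuityZ3.Theorems.AdditiveGluing.Negative.Cert

namespace GuardedTripodCex

open WorstPairExchangeCex (real_eq_wcount)

/-- **Evaluation of `μ(D₃ ∩ ({x ↔ c} ∩ {y ↔ d}))` on `Fin 7`.**  For a weighted pair list `l` (distinct pairs, weights in `[0,1]`),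
`μ(D₃ ∩ ({x↔c} ∩ {y↔d}))` (`D₃ = {0 ↮ 1} ∩ {0 ↮ 2} ∩ {1 ↮ 2}`) is the exact weighted count of the configurations whose reach table passes
the corresponding `Bool` test. [this file] -/
theorem real_D3_conn_conn {l : List (Fin 7 × Fin 7 × ℚ)} (hnd : (wPairs l).Nodup)
    (hq : ∀ e ∈ l, 0 ≤ e.2.2 ∧ e.2.2 ≤ 1) (x c y d : Fin 7) :
    (prodBernoulli (wOfList l)).real
        ((openConn (0 : Fin 7) (1 : Fin 7) : Set (BondConfig (Fin 7)))ᶜ ∩ (openConn (0 : Fin 7) (2 : Fin 7))ᶜ ∩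
          (openConn (1 : Fin 7) (2 : Fin 7))ᶜ ∩ (openConn x c ∩ openConn y d)) =
      ((((wtabs 7 l).map fun t =>
          if ((!(t.1.getD 0 0).testBit 1 && !(t.1.getD 0 0).testBit 2 && !(t.1.getD 1 0).testBit 2) &&
              ((t.1.getD x 0).testBit c && (t.1.getD y 0).testBit d)) then t.2 else 0).sum : ℚ) : ℝ) := by
  refine real_eq_wcount hnd hq (fun tb => (!(tb.getD 0 0).testBit 1 && !(tb.getD 0 0).testBit 2 && !(tb.getD 1 0).testBit 2) &&
      ((tb.getD x 0).testBit c && (tb.getD y 0).testBit d)) _ fun ω => ?_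
  have h01 : ((reachTable 7 ω).getD 0 0).testBit 1 = true ↔
      (↑(Eset ω) : Set (Sym2 (Fin 7))) ∈ openConn (0 : Fin 7) (1 : Fin 7) :=
    testBit_reachTable_iff_mem_openConn ω (0 : Fin 7) (1 : Fin 7)
  have h02 : ((reachTable 7 ω).getD 0 0).testBit 2 = true ↔
      (↑(Eset ω) : Set (Sym2 (Fin 7))) ∈ openConn (0 : Fin 7) (2 : Fin 7) :=
    testBit_reachTable_iff_mem_openConn ω (0 : Fin 7) (2 : Fin 7)
  have h12 : ((reachTable 7 ω).getD 1 0).testBit 2 = true ↔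
      (↑(Eset ω) : Set (Sym2 (Fin 7))) ∈ openConn (1 : Fin 7) (2 : Fin 7) :=
    testBit_reachTable_iff_mem_openConn ω (1 : Fin 7) (2 : Fin 7)
  have hxc : ((reachTable 7 ω).getD x 0).testBit c = true ↔
      (↑(Eset ω) : Set (Sym2 (Fin 7))) ∈ openConn x c :=
    testBit_reachTable_iff_mem_openConn ω x c
  have hyd : ((reachTable 7 ω).getD y 0).testBit d = true ↔
      (↑(Eset ω) : Set (Sym2 (Fin 7))) ∈ openConn y d :=
    testBit_reachTable_iff_mem_openConn ω y d
  simp only [Bool.and_eq_true, Bool.not_eq_true', Set.mem_inter_iff, Set.mem_compl_iff]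
  constructor
  · rintro ⟨⟨⟨h1, h2⟩, h3⟩, h4, h5⟩
    refine ⟨⟨⟨fun h => ?_, fun h => ?_⟩, fun h => ?_⟩, hxc.1 h4, hyd.1 h5⟩
    · rw [← h01] at h; rw [h] at h1; exact Bool.noConfusion h1
    · rw [← h02] at h; rw [h] at h2; exact Bool.noConfusion h2
    · rw [← h12] at h; rw [h] at h3; exact Bool.noConfusion h3
  · rintro ⟨⟨⟨h1, h2⟩, h3⟩, h4, h5⟩
    refine ⟨⟨⟨?_, ?_⟩, ?_⟩, hxc.2 h4, hyd.2 h5⟩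
    · cases h : ((reachTable 7 ω).getD 0 0).testBit 1
      · rfl
      · exact absurd (h01.1 h) h1
    · cases h : ((reachTable 7 ω).getD 0 0).testBit 2
      · rfl
      · exact absurd (h02.1 h) h2
    · cases h : ((reachTable 7 ω).getD 1 0).testBit 2
      · rfl
      · exact absurd (h12.1 h) h3

/-- **From one checkable rational fact to the violating instance.**  If the exact counts satisfy
`count(D₃,0↔3,0↔4) · count(D₃,1↔3,1↔4) < count(D₃,0↔3,1↔4) · count(D₃,0↔4,1↔3)` then under `prodBernoulli (wOfList l)` the guarded tripod
exchange fails strictly: `μ(D₃,sa,sb) μ(D₃,ta,tb) < μ(D₃,sa,tb) μ(D₃,sb,ta)` (`s=0,t=1,u=2,a=3,b=4`). [this file] -/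
theorem violation_of_check (l : List (Fin 7 × Fin 7 × ℚ)) (hnd : (wPairs l).Nodup)
    (hq : ∀ e ∈ l, 0 ≤ e.2.2 ∧ e.2.2 ≤ 1)
    (hlt : ((wtabs 7 l).map fun t =>
          if ((!(t.1.getD 0 0).testBit 1 && !(t.1.getD 0 0).testBit 2 && !(t.1.getD 1 0).testBit 2) &&
              ((t.1.getD (0 : Fin 7) 0).testBit (3 : Fin 7) && (t.1.getD (0 : Fin 7) 0).testBit (4 : Fin 7))) then t.2 else 0).sum *
        ((wtabs 7 l).map fun t =>
          if ((!(t.1.getD 0 0).testBit 1 && !(t.1.getD 0 0).testBit 2 && !(t.1.getD 1 0).testBit 2) &&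
              ((t.1.getD (1 : Fin 7) 0).testBit (3 : Fin 7) && (t.1.getD (1 : Fin 7) 0).testBit (4 : Fin 7))) then t.2 else 0).sum <
      ((wtabs 7 l).map fun t =>
          if ((!(t.1.getD 0 0).testBit 1 && !(t.1.getD 0 0).testBit 2 && !(t.1.getD 1 0).testBit 2) &&
              ((t.1.getD (0 : Fin 7) 0).testBit (3 : Fin 7) && (t.1.getD (1 : Fin 7) 0).testBit (4 : Fin 7))) then t.2 else 0).sum *
        ((wtabs 7 l).map fun t =>
          if ((!(t.1.getD 0 0).testBit 1 && !(t.1.getD 0 0).testBit 2 && !(t.1.getD 1 0).testBit 2) &&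
              ((t.1.getD (0 : Fin 7) 0).testBit (4 : Fin 7) && (t.1.getD (1 : Fin 7) 0).testBit (3 : Fin 7))) then t.2 else 0).sum) :
    (prodBernoulli (wOfList l)).real
        ((openConn (0 : Fin 7) (1 : Fin 7) : Set (BondConfig (Fin 7)))ᶜ ∩ (openConn (0 : Fin 7) (2 : Fin 7))ᶜ ∩
          (openConn (1 : Fin 7) (2 : Fin 7))ᶜ ∩ (openConn (0 : Fin 7) (3 : Fin 7) ∩ openConn (0 : Fin 7) (4 : Fin 7))) *
      (prodBernoulli (wOfList l)).real
        ((openConn (0 : Fin 7) (1 : Fin 7) : Set (BondConfig (Fin 7)))ᶜ ∩ (openConn (0 : Fin 7) (2 : Fin 7))ᶜ ∩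
          (openConn (1 : Fin 7) (2 : Fin 7))ᶜ ∩ (openConn (1 : Fin 7) (3 : Fin 7) ∩ openConn (1 : Fin 7) (4 : Fin 7))) <
    (prodBernoulli (wOfList l)).real
        ((openConn (0 : Fin 7) (1 : Fin 7) : Set (BondConfig (Fin 7)))ᶜ ∩ (openConn (0 : Fin 7) (2 : Fin 7))ᶜ ∩
          (openConn (1 : Fin 7) (2 : Fin 7))ᶜ ∩ (openConn (0 : Fin 7) (3 : Fin 7) ∩ openConn (1 : Fin 7) (4 : Fin 7))) *
      (prodBernoulli (wOfList l)).real
        ((openConn (0 : Fin 7) (1 : Fin 7) : Set (BondConfig (Fin 7)))ᶜ ∩ (openConn (0 : Fin 7) (2 : Fin 7))ᶜ ∩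
          (openConn (1 : Fin 7) (2 : Fin 7))ᶜ ∩ (openConn (0 : Fin 7) (4 : Fin 7) ∩ openConn (1 : Fin 7) (3 : Fin 7))) := by
  rw [real_D3_conn_conn hnd hq 0 3 0 4, real_D3_conn_conn hnd hq 1 3 1 4, real_D3_conn_conn hnd hq 0 3 1 4,
    real_D3_conn_conn hnd hq 0 4 1 3]
  exact_mod_cast hlt

end GuardedTripodCex

open GuardedTripodCex in
/-- **The tripod exchange fails under a two-sided guard: the instance ("twisted ladder", ttrl2 V9).**  There is a weight function
`w` on the pairs of `Fin 7` — `w(0,3) = w(0,5) = w(1,4) = w(1,6) = w(3,6) = w(4,5) = w(5,6) = 1/2`, `w(2,5) = w(2,6) = 10/11`, all other pairs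
`0` — such that for `μ = prodBernoulli w` and `D₃ = {0 ↮ 1} ∩ {0 ↮ 2} ∩ {1 ↮ 2}`
`μ(D₃ ∩ {0↔3} ∩ {0↔4}) · μ(D₃ ∩ {1↔3} ∩ {1↔4}) < μ(D₃ ∩ {0↔3} ∩ {1↔4}) · μ(D₃ ∩ {0↔4} ∩ {1↔3})`
(`(17/15488)² < (149/7744)·(1/15488)`, i.e. `L − R = −9/239878144`; exact rationals by `native_decide`).
[this file; witness from the census run/shared/lean/ttrl/k3cells/README.md, RESULT 04:55Z 2026-08-19] -/
theorem guardedTripod_cex : ∃ w : Sym2 (Fin 7) → unitInterval,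
    (prodBernoulli w).real
        ((openConn (0 : Fin 7) (1 : Fin 7) : Set (BondConfig (Fin 7)))ᶜ ∩ (openConn (0 : Fin 7) (2 : Fin 7))ᶜ ∩
          (openConn (1 : Fin 7) (2 : Fin 7))ᶜ ∩ (openConn (0 : Fin 7) (3 : Fin 7) ∩ openConn (0 : Fin 7) (4 : Fin 7))) *
      (prodBernoulli w).real
        ((openConn (0 : Fin 7) (1 : Fin 7) : Set (BondConfig (Fin 7)))ᶜ ∩ (openConn (0 : Fin 7) (2 : Fin 7))ᶜ ∩
          (openConn (1 : Fin 7) (2 : Fin 7))ᶜ ∩ (openConn (1 : Fin 7) (3 : Fin 7) ∩ openConn (1 : Fin 7) (4 : Fin 7))) <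
    (prodBernoulli w).real
        ((openConn (0 : Fin 7) (1 : Fin 7) : Set (BondConfig (Fin 7)))ᶜ ∩ (openConn (0 : Fin 7) (2 : Fin 7))ᶜ ∩
          (openConn (1 : Fin 7) (2 : Fin 7))ᶜ ∩ (openConn (0 : Fin 7) (3 : Fin 7) ∩ openConn (1 : Fin 7) (4 : Fin 7))) *
      (prodBernoulli w).real
        ((openConn (0 : Fin 7) (1 : Fin 7) : Set (BondConfig (Fin 7)))ᶜ ∩ (openConn (0 : Fin 7) (2 : Fin 7))ᶜ ∩
          (openConn (1 : Fin 7) (2 : Fin 7))ᶜ ∩ (openConn (0 : Fin 7) (4 : Fin 7) ∩ openConn (1 : Fin 7) (3 : Fin 7))) :=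
  ⟨_, violation_of_check
    [(0, 3, 1/2), (0, 5, 1/2), (1, 4, 1/2), (1, 6, 1/2), (3, 6, 1/2), (4, 5, 1/2), (5, 6, 1/2), (2, 5, 10/11), (2, 6, 10/11)]
    (by decide)
    (by
      intro e he
      simp only [List.mem_cons, List.not_mem_nil, or_false] at he
      rcases he with rfl | rfl | rfl | rfl | rfl | rfl | rfl | rfl | rfl <;> norm_num)
    (by native_decide)⟩

/-- **No-go for the k-cluster line: the tripod exchange (C⁺) does NOT survive a two-sided guard.**  It is false that for every finite
weighted graph and all pairwise distinct `s, t, u, a, b`, with `D₃ = {s ↮ t} ∩ {s ↮ u} ∩ {t ↮ u}` ("`s, t, u` in three different clusters"),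
`μ(D₃ ∩ {s↔a} ∩ {t↔b}) · μ(D₃ ∩ {s↔b} ∩ {t↔a}) ≤ μ(D₃ ∩ {s↔a} ∩ {s↔b}) · μ(D₃ ∩ {t↔a} ∩ {t↔b})`
— although without the guard `u` this is the theorem `tripodExchange`.  Witness `guardedTripod_cex` (`n = 7`, `(s,t,u,a,b) = (0,1,2,3,4)`,
the "twisted ladder" of ttrl2; `μ(D₃) ≈ 0.16`, hub weights `10/11`, all other weights `1/2`). [this file] -/
theorem guardedTripod_false :
    ¬ (∀ (n : ℕ) (w : Sym2 (Fin n) → unitInterval) (s t u a b : Fin n), [s, t, u, a, b].Nodup →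
      (prodBernoulli w).real ((openConn s t : Set (BondConfig (Fin n)))ᶜ ∩ (openConn s u)ᶜ ∩ (openConn t u)ᶜ ∩
          (openConn s a ∩ openConn t b)) *
        (prodBernoulli w).real ((openConn s t : Set (BondConfig (Fin n)))ᶜ ∩ (openConn s u)ᶜ ∩ (openConn t u)ᶜ ∩
          (openConn s b ∩ openConn t a)) ≤
      (prodBernoulli w).real ((openConn s t : Set (BondConfig (Fin n)))ᶜ ∩ (openConn s u)ᶜ ∩ (openConn t u)ᶜ ∩
          (openConn s a ∩ openConn s b)) *
        (prodBernoulli w).real ((openConn s t : Set (BondConfig (Fin n)))ᶜ ∩ (openConn s u)ᶜ ∩ (openConn t u)ᶜ ∩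
          (openConn t a ∩ openConn t b))) := by
  intro h
  obtain ⟨w, hgt⟩ := guardedTripod_cex
  have hle := h 7 w 0 1 2 3 4 (by decide)
  exact absurd hle (not_le.2 hgt)

end Summit.CriticalPhenomena.PercolationContinuityZ3.Theorems
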